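import Summits.KontsevichZagierPeriods.Zeta5Search.Barrier.ConeGammaCuspPeriodGordanCanonical

/-!
# ζ(5) search — BARRIER: THE CHAMBER FARKAS CERTIFICATE — a complete, type-free, chamber-by-chamber criterion for a cusp top

HONEST FRAMING (cell `pub-zeta5`): systematic search; no irrationality claim unless kernel-certified. MODEL objects
under Brown–Zudilin's (28)+(30) accounting ([BZ22] = arXiv:2210.03391; (28) observed, not proved); nothing here is a
statement about `ζ(5)`, any `γ` of record, the cone's supremum (C2 OPEN) or the value / sign of the cusp slope, of a
chamber weight or of a multiplier at a named direction (DATA of the cell); NO certificate instance is asserted for any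
named direction (at record/41, flag/60, argmax-120, t*/480 ascent directions exist — DATA); S-E stays CONJECTURED;
records in print UNMOVED. Prover P2 g34, item «GORDAN'S ALTERNATIVE FOR THE CUSP SLOPE», file (3) (theorems only).

THE POINT. On the closed chamber `C(δ₀) = {δ : ρ₀ k < ρ₀ l ⇒ r_k(δ) ≤ r_l(δ)}` of a generic reference `δ₀` the cusp
slope IS the linear chamber functional `G_{δ₀}(δ) = Σ_k W_k(δ₀)·r_k(δ)` (P2 g31 `cuspSlope_eq_greedy_period_of_refines`),
and `C(δ₀)` is a polyhedral cone given by its INEQUALITIES (an H-cone: the wall gaps `r_l − r_k ≥ 0`, `ρ₀ k < ρ₀ l`).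
So «`σ ≤ 0` on `C(δ₀)`» is the statement that one linear functional is non-positive on an H-cone, and the tree's FARKAS
LEMMA (`Literature.Analysis.Convex.LPDuality.farkas_nonneg_eq`, Schrijver 1986 Cor. 7.1d) makes it a finite identity:
* `pairSum_eq_sum_coeff`, `chamberFarkas_eq_sum_coord` — the certificate expression is a weighted rate functional,
  hence linear in the 8 coordinates;
* **`cuspSlope_nonpos_of_refines_of_farkas_certificate`** (SOUND, any `F`): multipliers `μ_{kl} ≥ 0` on the ordered
  pairs `ρ₀ k < ρ₀ l` with `G_{δ₀}(δ) + Σ_{ρ₀k<ρ₀l} μ_{kl}·(r_l(δ) − r_k(δ)) = 0` for every `δ` give `σ ≤ 0` on the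
  whole closed chamber of `δ₀` (each wall gap is `≥ 0` there);
* **`exists_farkas_certificate_of_cuspSlope_nonpos_on_chamber`** (COMPLETE, any `F`): conversely, if `σ ≤ 0` on the
  closed chamber of a generic `δ₀`, such multipliers EXIST (Farkas);
* **`exists_ascent_in_chamber_iff_no_farkas_certificate`** — THE CHAMBER FARKAS ALTERNATIVE: for every generic `δ₀`
  EXACTLY ONE of — an ascent direction `δ ∈ C(δ₀)` (`σ(δ) > 0`), or the chamber's Farkas certificate; so an LP that
  fails to certify a chamber PRODUCES an ascent direction inside it;
* **`forall_cuspSlope_nonpos_iff_forall_farkas_certificate`** — A CUSP TOP, EXACTLY: `σ ≤ 0` in every direction IFF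
  every generic reference carries a Farkas certificate (the generic chambers cover `ℝ⁸`, `exists_generic_refines`) — a
  necessary AND sufficient condition with NO type hypothesis, chamber by chamber, each a finite rational identity
  (`…_coord`: checkable on the 8 coordinate displacements); canonical forms with hpos / hT / hper / hF only.
Compared with the cell's other certificates: P2 g29's per-chamber test needs GENERATORS of the chamber (a V-description),
P2 g32/g33's cone certificates pay the junction-count slack off the chamber; the Farkas form uses the chamber's own 27·14
inequalities and is exact. What stays DATA: how many sampled chambers at a named direction carry a certificate
(`HOME/pub-zeta5-p2/g34/alg/`); no multiplier or sign at a named direction enters the kernel; nothing about `γ`, C2,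
S-E or `ζ(5)`.
-/

noncomputable section

open Set MeasureTheory Finset
open scoped Topology

namespace Summit.KontsevichZagierPeriods.Zeta5Search.Barrier.ConeGamma

/-! ### The certificate expression is a weighted rate functional -/

/-- A multiplier sum over ordered pairs, `Σ_k Σ_l [c k l]·μ_{kl}·(x_l − x_k)`, is the weighted sum
`Σ_k (Σ_l [c l k] μ_{lk} − Σ_l [c k l] μ_{kl})·x_k`. -/
theorem pairSum_eq_sum_coeff (c : Fin 28 → Fin 28 → Prop) [∀ k l, Decidable (c k l)] (μ : Fin 28 → Fin 28 → ℝ)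
    (x : Fin 28 → ℝ) :
    ∑ k, ∑ l, (if c k l then μ k l * (x l - x k) else 0) =
      ∑ k, ((∑ l, if c l k then μ l k else 0) - ∑ l, if c k l then μ k l else 0) * x k := by
  have h1 : ∀ k l, (if c k l then μ k l * (x l - x k) else 0) =
      (if c k l then μ k l else 0) * x l - (if c k l then μ k l else 0) * x k := fun k l => by
    split_ifs <;> ring
  simp_rw [h1, Finset.sum_sub_distrib, sub_mul, Finset.sum_mul]
  rw [Finset.sum_comm, ← Finset.sum_sub_distrib]

/-- **The Farkas certificate expression is linear in the displacement**: for any weights `W`, multipliers `μ` and pair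
selection `c`, `E(δ) = Σ_k W_k·r_k(δ) + Σ_k Σ_l [c k l]·μ_{kl}·(r_l(δ) − r_k(δ))` satisfies `E(δ) = Σ_p δ_p·E(e_p)`. -/
theorem chamberFarkas_eq_sum_coord (a : Dir) (c : Fin 28 → Fin 28 → Prop) [∀ k l, Decidable (c k l)]
    (W : Fin 28 → ℝ) (μ : Fin 28 → Fin 28 → ℝ) (δ : Fin 8 → ℝ) :
    ∑ k, W k * (phiForm δ k / h28 a k) +
        ∑ k, ∑ l, (if c k l then μ k l * (phiForm δ l / h28 a l - phiForm δ k / h28 a k) else 0) =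
      ∑ p, δ p * (∑ k, W k * (phiForm (Pi.single p (1 : ℝ)) k / h28 a k) +
        ∑ k, ∑ l, (if c k l then μ k l *
          (phiForm (Pi.single p (1 : ℝ)) l / h28 a l - phiForm (Pi.single p (1 : ℝ)) k / h28 a k) else 0)) := by
  have hE : ∀ θ : Fin 8 → ℝ, ∑ k, W k * (phiForm θ k / h28 a k) +
      ∑ k, ∑ l, (if c k l then μ k l * (phiForm θ l / h28 a l - phiForm θ k / h28 a k) else 0) =
      ∑ k, (W k + ((∑ l, if c l k then μ l k else 0) - ∑ l, if c k l then μ k l else 0)) *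
        (phiForm θ k / h28 a k) := fun θ => by
    rw [pairSum_eq_sum_coeff c μ fun k => phiForm θ k / h28 a k, ← Finset.sum_add_distrib]
    exact Finset.sum_congr rfl fun k _ => by ring
  simp_rw [hE]
  exact sum_mul_rate_eq_sum_coord a _ δ

/-! ### Soundness: a Farkas certificate bounds σ on the whole closed chamber -/

/-- **On the closed chamber of a generic reference every selected wall gap is non-negative**: if `δ` is refined by
`δ₀` (`r_k(δ) < r_l(δ) ⇒ ρ₀ k < ρ₀ l`) and `ρ₀ k < ρ₀ l`, then `r_k(δ) ≤ r_l(δ)`. -/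
theorem rate_le_rate_of_refines {a : Dir} {δ₀ δ : Fin 8 → ℝ}
    (href : ∀ k l : Fin 28, phiForm δ k / h28 a k < phiForm δ l / h28 a l →
      phiForm δ₀ k / h28 a k < phiForm δ₀ l / h28 a l)
    {k l : Fin 28} (hkl : phiForm δ₀ k / h28 a k < phiForm δ₀ l / h28 a l) :
    phiForm δ k / h28 a k ≤ phiForm δ l / h28 a l := by
  by_contra h
  exact (lt_asymm hkl) (href l k (not_le.mp h))

/-- Conversely, for a GENERIC reference: if every wall gap selected by `δ₀`'s order is non-negative at `δ`, then `δ` is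
refined by `δ₀`. -/
theorem refines_of_forall_rate_le {a : Dir} {δ₀ δ : Fin 8 → ℝ}
    (hgen : ∀ k l : Fin 28, k ≠ l → phiForm δ₀ k / h28 a k ≠ phiForm δ₀ l / h28 a l)
    (h : ∀ k l : Fin 28, phiForm δ₀ k / h28 a k < phiForm δ₀ l / h28 a l →
      phiForm δ k / h28 a k ≤ phiForm δ l / h28 a l) :
    ∀ k l : Fin 28, phiForm δ k / h28 a k < phiForm δ l / h28 a l →
      phiForm δ₀ k / h28 a k < phiForm δ₀ l / h28 a l := by
  intro k l hkl
  have hne : k ≠ l := fun e => by rw [e] at hkl; exact lt_irrefl _ hkl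
  rcases lt_or_gt_of_ne (hgen k l hne) with hlt | hgt
  · exact hlt
  · exact absurd (h l k hgt) (not_le.mpr hkl)

/-- **SOUNDNESS OF THE CHAMBER FARKAS CERTIFICATE** (any period pattern function `F`, any extension). All 28 forms of
`a` positive, `T > 0` a period, `δ₀` a generic reference with chamber weights `W_k(δ₀) = F(P≤(k)) − F(P<(k))`. If
multipliers `μ_{kl} ≥ 0` satisfy, for every displacement `δ`,
`Σ_k W_k(δ₀)·r_k(δ) + Σ_{ρ₀k<ρ₀l} μ_{kl}·(r_l(δ) − r_k(δ)) = 0`,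
then `cuspSlope a T δ ≤ 0` for EVERY `δ` in the closed chamber of `δ₀` (`σ = G_{δ₀}` there, and each gap is `≥ 0`). -/
theorem cuspSlope_nonpos_of_refines_of_farkas_certificate {a : Dir} (hpos : ∀ k, 0 < h28 a k) {T : ℝ} (hT : 0 < T)
    (hper : ∀ k : Fin 28, ∃ z : ℤ, T * h28 a k = z)
    {M : ℕ → Finset (Fin 28)} {f : ℕ → Finset (Fin 28) → ℝ}
    (hf : ∀ m, m + 1 < (bkpts a T).card → ∀ Δ : Fin 8 → ℝ, (∀ k, |phiForm Δ k| < 1) →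
      (∀ k, |phiForm Δ k| < wallDist a T) →
        (torusN (bkpt a T m • sParam a + Δ) : ℝ) = f m ((M m).filter fun k => 0 ≤ phiForm Δ k))
    {F : Finset (Fin 28) → ℝ} (hF : ∀ A, F A = ∑ m ∈ Finset.range ((bkpts a T).card - 1), f m (A ∩ M m))
    {δ₀ : Fin 8 → ℝ} (hgen : ∀ k l : Fin 28, k ≠ l → phiForm δ₀ k / h28 a k ≠ phiForm δ₀ l / h28 a l)
    {μ : Fin 28 → Fin 28 → ℝ} (hμ : ∀ k l, 0 ≤ μ k l)
    (hid : ∀ δ : Fin 8 → ℝ,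
      ∑ k, (F (Finset.univ.filter fun l => phiForm δ₀ k / h28 a k ≤ phiForm δ₀ l / h28 a l) -
          F (Finset.univ.filter fun l => phiForm δ₀ k / h28 a k < phiForm δ₀ l / h28 a l)) *
        (phiForm δ k / h28 a k) +
      ∑ k, ∑ l, (if phiForm δ₀ k / h28 a k < phiForm δ₀ l / h28 a l then
        μ k l * (phiForm δ l / h28 a l - phiForm δ k / h28 a k) else 0) = 0)
    (δ : Fin 8 → ℝ) (href : ∀ k l : Fin 28, phiForm δ k / h28 a k < phiForm δ l / h28 a l →
      phiForm δ₀ k / h28 a k < phiForm δ₀ l / h28 a l) :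
    cuspSlope a T δ ≤ 0 := by
  rw [cuspSlope_eq_greedy_period_of_refines hpos hT hper hf hF hgen δ href]
  have hgap : 0 ≤ ∑ k, ∑ l, (if phiForm δ₀ k / h28 a k < phiForm δ₀ l / h28 a l then
      μ k l * (phiForm δ l / h28 a l - phiForm δ k / h28 a k) else 0) :=
    Finset.sum_nonneg fun k _ => Finset.sum_nonneg fun l _ => by
      split_ifs with hkl
      · exact mul_nonneg (hμ k l) (sub_nonneg.mpr (rate_le_rate_of_refines href hkl))
      · exact le_rfl
  linarith [hid δ]

/-! ### Completeness: Farkas' lemma on the H-cone of the chamber -/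

/-- **COMPLETENESS OF THE CHAMBER FARKAS CERTIFICATE** (any period pattern function `F`, any extension — the tree's
FARKAS LEMMA `Literature.Analysis.Convex.LPDuality.farkas_nonneg_eq`, Schrijver 1986 Cor. 7.1d, on the H-cone of the
chamber). All 28 forms of `a` positive, `T > 0` a period, `δ₀` generic. If `cuspSlope a T δ ≤ 0` for every `δ` in the
closed chamber of `δ₀`, then there are multipliers `μ_{kl} ≥ 0` with
`Σ_k W_k(δ₀)·r_k(δ) + Σ_{ρ₀k<ρ₀l} μ_{kl}·(r_l(δ) − r_k(δ)) = 0` for every `δ`: the chamber functional is a non-positive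
combination of its own chamber's wall gaps. -/
theorem exists_farkas_certificate_of_cuspSlope_nonpos_on_chamber {a : Dir} (hpos : ∀ k, 0 < h28 a k) {T : ℝ}
    (hT : 0 < T) (hper : ∀ k : Fin 28, ∃ z : ℤ, T * h28 a k = z)
    {M : ℕ → Finset (Fin 28)} {f : ℕ → Finset (Fin 28) → ℝ}
    (hf : ∀ m, m + 1 < (bkpts a T).card → ∀ Δ : Fin 8 → ℝ, (∀ k, |phiForm Δ k| < 1) →
      (∀ k, |phiForm Δ k| < wallDist a T) →
        (torusN (bkpt a T m • sParam a + Δ) : ℝ) = f m ((M m).filter fun k => 0 ≤ phiForm Δ k))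
    {F : Finset (Fin 28) → ℝ} (hF : ∀ A, F A = ∑ m ∈ Finset.range ((bkpts a T).card - 1), f m (A ∩ M m))
    {δ₀ : Fin 8 → ℝ} (hgen : ∀ k l : Fin 28, k ≠ l → phiForm δ₀ k / h28 a k ≠ phiForm δ₀ l / h28 a l)
    (hnonpos : ∀ δ : Fin 8 → ℝ, (∀ k l : Fin 28, phiForm δ k / h28 a k < phiForm δ l / h28 a l →
      phiForm δ₀ k / h28 a k < phiForm δ₀ l / h28 a l) → cuspSlope a T δ ≤ 0) :
    ∃ μ : Fin 28 → Fin 28 → ℝ, (∀ k l, 0 ≤ μ k l) ∧ ∀ δ : Fin 8 → ℝ,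
      ∑ k, (F (Finset.univ.filter fun l => phiForm δ₀ k / h28 a k ≤ phiForm δ₀ l / h28 a l) -
          F (Finset.univ.filter fun l => phiForm δ₀ k / h28 a k < phiForm δ₀ l / h28 a l)) *
        (phiForm δ k / h28 a k) +
      ∑ k, ∑ l, (if phiForm δ₀ k / h28 a k < phiForm δ₀ l / h28 a l then
        μ k l * (phiForm δ l / h28 a l - phiForm δ k / h28 a k) else 0) = 0 := by
  classical
  -- shorthand: weights, rates on the coordinate displacements, the pair selection
  obtain ⟨W, hW⟩ : ∃ W : Fin 28 → ℝ, ∀ k, W k =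
      F (Finset.univ.filter fun l => phiForm δ₀ k / h28 a k ≤ phiForm δ₀ l / h28 a l) -
        F (Finset.univ.filter fun l => phiForm δ₀ k / h28 a k < phiForm δ₀ l / h28 a l) := ⟨_, fun _ => rfl⟩
  obtain ⟨R, hR⟩ : ∃ R : Fin 8 → Fin 28 → ℝ, ∀ p k, R p k = phiForm (Pi.single p (1 : ℝ)) k / h28 a k :=
    ⟨_, fun _ _ => rfl⟩
  have hrate : ∀ (y : Fin 8 → ℝ) k, phiForm y k / h28 a k = ∑ p, y p * R p k := fun y k => by
    simp only [hR]; rw [phiForm_eq_sum_coord y k, Finset.sum_div]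
    exact Finset.sum_congr rfl fun p _ => by ring
  -- the chamber functional is `σ` on the closed chamber, hence `≤ 0` there
  have hG : ∀ y : Fin 8 → ℝ, (∀ k l : Fin 28, phiForm δ₀ k / h28 a k < phiForm δ₀ l / h28 a l →
      phiForm y k / h28 a k ≤ phiForm y l / h28 a l) → ∑ k, W k * (phiForm y k / h28 a k) ≤ 0 := fun y hy => by
    have href := refines_of_forall_rate_le hgen hy
    have h := hnonpos y href
    rw [cuspSlope_eq_greedy_period_of_refines hpos hT hper hf hF hgen y href] at h
    simpa only [hW] using h
  -- Farkas: columns = the selected wall-gap gradients, right-hand side = minus the chamber gradient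
  have hFarkas := (Literature.Analysis.Convex.LPDuality.farkas_nonneg_eq (𝕜 := ℝ)
    (fun (p : Fin 8) (kl : Fin 28 × Fin 28) =>
      if phiForm δ₀ kl.1 / h28 a kl.1 < phiForm δ₀ kl.2 / h28 a kl.2 then R p kl.2 - R p kl.1 else 0 :
        Matrix (Fin 8) (Fin 28 × Fin 28) ℝ)
    (fun p => -∑ k, W k * R p k)).mpr ?_
  · obtain ⟨x, hx0, hAx⟩ := hFarkas
    -- the identity with the folded weights, at every displacement
    have key : ∀ δ : Fin 8 → ℝ, ∑ k, W k * (phiForm δ k / h28 a k) +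
        ∑ k, ∑ l, (if phiForm δ₀ k / h28 a k < phiForm δ₀ l / h28 a l then
          x (k, l) * (phiForm δ l / h28 a l - phiForm δ k / h28 a k) else 0) = 0 := fun δ => by
      rw [chamberFarkas_eq_sum_coord]
      refine Finset.sum_eq_zero fun p _ => ?_
      have hp := congrFun hAx p
      simp only [Matrix.mulVec, dotProduct] at hp
      rw [Fintype.sum_prod_type] at hp
      dsimp only at hp
      -- `hp : Σ_k Σ_l [ρ₀k<ρ₀l]·(R p l − R p k)·x(k,l) = −Σ_k W k · R p k`
      have hp' : ∑ k, ∑ l, (if phiForm δ₀ k / h28 a k < phiForm δ₀ l / h28 a l then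
          x (k, l) * (R p l - R p k) else 0) = -∑ k, W k * R p k := by
        rw [← hp]
        exact Finset.sum_congr rfl fun k _ => Finset.sum_congr rfl fun l _ => by split_ifs <;> ring
      simp only [← hR]
      rw [hp', add_neg_cancel, mul_zero]
    refine ⟨fun k l => x (k, l), fun k l => hx0 (k, l), fun δ => ?_⟩
    simpa only [hW] using key δ
  · intro y hy
    -- `0 ≤ y ᵥ* A`: every selected wall gap is `≥ 0` at `y`, so `y` lies in the closed chamber
    have hy' : ∀ k l : Fin 28, phiForm δ₀ k / h28 a k < phiForm δ₀ l / h28 a l →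
        phiForm y k / h28 a k ≤ phiForm y l / h28 a l := fun k l hkl => by
      have h := hy (k, l)
      simp only [Matrix.vecMul, dotProduct, Pi.zero_apply] at h
      simp only [if_pos hkl, mul_sub, Finset.sum_sub_distrib] at h
      rw [hrate y k, hrate y l]
      linarith
    have h := hG y hy'
    simp only [dotProduct, mul_neg, Finset.sum_neg_distrib]
    rw [le_neg, neg_zero]
    calc ∑ p, y p * ∑ k, W k * R p k = ∑ k, W k * ∑ p, y p * R p k := by
          simp_rw [Finset.mul_sum]; rw [Finset.sum_comm]
          exact Finset.sum_congr rfl fun k _ => Finset.sum_congr rfl fun p _ => by ring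
      _ = ∑ k, W k * (phiForm y k / h28 a k) := Finset.sum_congr rfl fun k _ => by rw [hrate y k]
      _ ≤ 0 := h

/-- **The certificate identity need only be checked on the 8 coordinate displacements** (it is linear in `δ`). -/
theorem chamberFarkas_forall_iff_coord (a : Dir) (c : Fin 28 → Fin 28 → Prop) [∀ k l, Decidable (c k l)]
    (W : Fin 28 → ℝ) (μ : Fin 28 → Fin 28 → ℝ) :
    (∀ δ : Fin 8 → ℝ, ∑ k, W k * (phiForm δ k / h28 a k) +
        ∑ k, ∑ l, (if c k l then μ k l * (phiForm δ l / h28 a l - phiForm δ k / h28 a k) else 0) = 0) ↔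
      ∀ p : Fin 8, ∑ k, W k * (phiForm (Pi.single p (1 : ℝ)) k / h28 a k) +
        ∑ k, ∑ l, (if c k l then μ k l *
          (phiForm (Pi.single p (1 : ℝ)) l / h28 a l - phiForm (Pi.single p (1 : ℝ)) k / h28 a k) else 0) = 0 := by
  refine ⟨fun h p => h _, fun h δ => ?_⟩
  rw [chamberFarkas_eq_sum_coord]
  exact Finset.sum_eq_zero fun p _ => by rw [h p, mul_zero]

/-! ### The chamber Farkas alternative, and the exact criterion for a cusp top -/

/-- **THE CHAMBER FARKAS ALTERNATIVE** (any period pattern function, any extension). All 28 forms of `a` positive,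
`T > 0` a period, `δ₀` a generic reference. EXACTLY ONE of: (i) the closed chamber of `δ₀` contains an ASCENT DIRECTION
(`δ` refined by `δ₀` with `0 < cuspSlope a T δ`); (ii) the chamber carries a FARKAS CERTIFICATE (`μ ≥ 0` with
`G_{δ₀} + Σ_{ρ₀k<ρ₀l} μ_{kl}·(r_l − r_k) ≡ 0`). Stated as: an ascent direction in the chamber exists iff no certificate
does — so a failed certification PRODUCES an ascent direction inside that chamber. -/
theorem exists_ascent_in_chamber_iff_no_farkas_certificate {a : Dir} (hpos : ∀ k, 0 < h28 a k) {T : ℝ}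
    (hT : 0 < T) (hper : ∀ k : Fin 28, ∃ z : ℤ, T * h28 a k = z)
    {M : ℕ → Finset (Fin 28)} {f : ℕ → Finset (Fin 28) → ℝ}
    (hf : ∀ m, m + 1 < (bkpts a T).card → ∀ Δ : Fin 8 → ℝ, (∀ k, |phiForm Δ k| < 1) →
      (∀ k, |phiForm Δ k| < wallDist a T) →
        (torusN (bkpt a T m • sParam a + Δ) : ℝ) = f m ((M m).filter fun k => 0 ≤ phiForm Δ k))
    {F : Finset (Fin 28) → ℝ} (hF : ∀ A, F A = ∑ m ∈ Finset.range ((bkpts a T).card - 1), f m (A ∩ M m))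
    {δ₀ : Fin 8 → ℝ} (hgen : ∀ k l : Fin 28, k ≠ l → phiForm δ₀ k / h28 a k ≠ phiForm δ₀ l / h28 a l) :
    (∃ δ : Fin 8 → ℝ, (∀ k l : Fin 28, phiForm δ k / h28 a k < phiForm δ l / h28 a l →
        phiForm δ₀ k / h28 a k < phiForm δ₀ l / h28 a l) ∧ 0 < cuspSlope a T δ) ↔
      ¬ ∃ μ : Fin 28 → Fin 28 → ℝ, (∀ k l, 0 ≤ μ k l) ∧ ∀ δ : Fin 8 → ℝ,
        ∑ k, (F (Finset.univ.filter fun l => phiForm δ₀ k / h28 a k ≤ phiForm δ₀ l / h28 a l) -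
            F (Finset.univ.filter fun l => phiForm δ₀ k / h28 a k < phiForm δ₀ l / h28 a l)) *
          (phiForm δ k / h28 a k) +
        ∑ k, ∑ l, (if phiForm δ₀ k / h28 a k < phiForm δ₀ l / h28 a l then
          μ k l * (phiForm δ l / h28 a l - phiForm δ k / h28 a k) else 0) = 0 := by
  constructor
  · rintro ⟨δ, href, hδ⟩ ⟨μ, hμ, hid⟩
    exact (cuspSlope_nonpos_of_refines_of_farkas_certificate hpos hT hper hf hF hgen hμ hid δ href).not_gt hδ
  · intro h
    by_contra hne
    push Not at hne
    exact h (exists_farkas_certificate_of_cuspSlope_nonpos_on_chamber hpos hT hper hf hF hgen hne)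

/-- **A CUSP TOP, EXACTLY — THE FARKAS FORM** (any period pattern function, any extension, NO type hypothesis). All 28
forms of `a` positive, `T > 0` a period. `cuspSlope a T δ ≤ 0` for EVERY displacement `δ` IF AND ONLY IF every generic
reference `δ₀` carries a Farkas certificate: `μ ≥ 0` with
`Σ_k W_k(δ₀)·r_k(δ) + Σ_{ρ₀k<ρ₀l} μ_{kl}·(r_l(δ) − r_k(δ)) = 0` for all `δ` — its chamber functional is a non-positive
combination of its own chamber's wall gaps. (⇒ Farkas per chamber; ⇐ the generic closed chambers cover `ℝ⁸`,
`exists_generic_refines`.) The certificate depends on `δ₀` only through the order of its 28 rates: finitely many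
rational identities in all, though over a large index set; none is asserted for a named direction. -/
theorem forall_cuspSlope_nonpos_iff_forall_farkas_certificate {a : Dir} (hpos : ∀ k, 0 < h28 a k) {T : ℝ}
    (hT : 0 < T) (hper : ∀ k : Fin 28, ∃ z : ℤ, T * h28 a k = z)
    {M : ℕ → Finset (Fin 28)} {f : ℕ → Finset (Fin 28) → ℝ}
    (hf : ∀ m, m + 1 < (bkpts a T).card → ∀ Δ : Fin 8 → ℝ, (∀ k, |phiForm Δ k| < 1) →
      (∀ k, |phiForm Δ k| < wallDist a T) →
        (torusN (bkpt a T m • sParam a + Δ) : ℝ) = f m ((M m).filter fun k => 0 ≤ phiForm Δ k))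
    {F : Finset (Fin 28) → ℝ} (hF : ∀ A, F A = ∑ m ∈ Finset.range ((bkpts a T).card - 1), f m (A ∩ M m)) :
    (∀ δ, cuspSlope a T δ ≤ 0) ↔
      ∀ δ₀ : Fin 8 → ℝ, (∀ k l : Fin 28, k ≠ l → phiForm δ₀ k / h28 a k ≠ phiForm δ₀ l / h28 a l) →
        ∃ μ : Fin 28 → Fin 28 → ℝ, (∀ k l, 0 ≤ μ k l) ∧ ∀ δ : Fin 8 → ℝ,
          ∑ k, (F (Finset.univ.filter fun l => phiForm δ₀ k / h28 a k ≤ phiForm δ₀ l / h28 a l) -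
              F (Finset.univ.filter fun l => phiForm δ₀ k / h28 a k < phiForm δ₀ l / h28 a l)) *
            (phiForm δ k / h28 a k) +
          ∑ k, ∑ l, (if phiForm δ₀ k / h28 a k < phiForm δ₀ l / h28 a l then
            μ k l * (phiForm δ l / h28 a l - phiForm δ k / h28 a k) else 0) = 0 := by
  constructor
  · intro h δ₀ hgen
    exact exists_farkas_certificate_of_cuspSlope_nonpos_on_chamber hpos hT hper hf hF hgen fun δ _ => h δ
  · intro h δ
    obtain ⟨δ₀, hgen, href⟩ := exists_generic_refines hpos δ
    obtain ⟨μ, hμ, hid⟩ := h δ₀ hgen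
    exact cuspSlope_nonpos_of_refines_of_farkas_certificate hpos hT hper hf hF hgen hμ hid δ href

/-! ### Canonical forms: the saving's own period pattern function -/

/-- **THE CHAMBER FARKAS ALTERNATIVE — CANONICAL FORM, NO STRUCTURAL HYPOTHESIS.** All 28 forms of `a` positive, `T > 0`
a period, `F = Σ_m patternN a b_m` the canonical period pattern function (P2 g33), `δ₀` generic: the closed chamber of `δ₀`
contains an ascent direction iff NO `μ ≥ 0` has `Σ_k W_k(δ₀)·r_k + Σ_{ρ₀k<ρ₀l} μ_{kl}(r_l − r_k) ≡ 0`. -/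
theorem exists_ascent_in_chamber_iff_no_farkas_certificate_canonical {a : Dir} (hpos : ∀ k, 0 < h28 a k) {T : ℝ}
    (hT : 0 < T) (hper : ∀ k : Fin 28, ∃ z : ℤ, T * h28 a k = z) {F : Finset (Fin 28) → ℝ}
    (hF : ∀ A, F A = ∑ m ∈ Finset.range ((bkpts a T).card - 1), ((patternN a (bkpt a T m) A : ℤ) : ℝ))
    {δ₀ : Fin 8 → ℝ} (hgen : ∀ k l : Fin 28, k ≠ l → phiForm δ₀ k / h28 a k ≠ phiForm δ₀ l / h28 a l) :
    (∃ δ : Fin 8 → ℝ, (∀ k l : Fin 28, phiForm δ k / h28 a k < phiForm δ l / h28 a l →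
        phiForm δ₀ k / h28 a k < phiForm δ₀ l / h28 a l) ∧ 0 < cuspSlope a T δ) ↔
      ¬ ∃ μ : Fin 28 → Fin 28 → ℝ, (∀ k l, 0 ≤ μ k l) ∧ ∀ δ : Fin 8 → ℝ,
        ∑ k, (F (Finset.univ.filter fun l => phiForm δ₀ k / h28 a k ≤ phiForm δ₀ l / h28 a l) -
            F (Finset.univ.filter fun l => phiForm δ₀ k / h28 a k < phiForm δ₀ l / h28 a l)) *
          (phiForm δ k / h28 a k) +
        ∑ k, ∑ l, (if phiForm δ₀ k / h28 a k < phiForm δ₀ l / h28 a l then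
          μ k l * (phiForm δ l / h28 a l - phiForm δ k / h28 a k) else 0) = 0 := by
  classical
  exact exists_ascent_in_chamber_iff_no_farkas_certificate hpos hT hper
    (M := fun m => Finset.univ.filter fun k => ∃ z : ℤ, bkpt a T m * h28 a k = z)
    (f := fun m A => ((patternN a (bkpt a T m) A : ℤ) : ℝ)) (canonical_junction_agreement a T)
    (canonical_period_eq_sum_inter hF) hgen

/-- **A CUSP TOP, EXACTLY — CANONICAL FORM, NO STRUCTURAL HYPOTHESIS.** All 28 forms of `a` positive, `T > 0` a period,
`F = Σ_m patternN a b_m` the canonical period pattern function: `cuspSlope a T δ ≤ 0` for every `δ` IFF every generic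
reference carries a Farkas certificate `μ ≥ 0`, `Σ_k W_k(δ₀)·r_k + Σ_{ρ₀k<ρ₀l} μ_{kl}(r_l − r_k) ≡ 0` — the inputs are the
direction, the period and the saving's own formula; necessary AND sufficient; no instance asserted. -/
theorem forall_cuspSlope_nonpos_iff_forall_farkas_certificate_canonical {a : Dir} (hpos : ∀ k, 0 < h28 a k) {T : ℝ}
    (hT : 0 < T) (hper : ∀ k : Fin 28, ∃ z : ℤ, T * h28 a k = z) {F : Finset (Fin 28) → ℝ}
    (hF : ∀ A, F A = ∑ m ∈ Finset.range ((bkpts a T).card - 1), ((patternN a (bkpt a T m) A : ℤ) : ℝ)) :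
    (∀ δ, cuspSlope a T δ ≤ 0) ↔
      ∀ δ₀ : Fin 8 → ℝ, (∀ k l : Fin 28, k ≠ l → phiForm δ₀ k / h28 a k ≠ phiForm δ₀ l / h28 a l) →
        ∃ μ : Fin 28 → Fin 28 → ℝ, (∀ k l, 0 ≤ μ k l) ∧ ∀ δ : Fin 8 → ℝ,
          ∑ k, (F (Finset.univ.filter fun l => phiForm δ₀ k / h28 a k ≤ phiForm δ₀ l / h28 a l) -
              F (Finset.univ.filter fun l => phiForm δ₀ k / h28 a k < phiForm δ₀ l / h28 a l)) *
            (phiForm δ k / h28 a k) +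
          ∑ k, ∑ l, (if phiForm δ₀ k / h28 a k < phiForm δ₀ l / h28 a l then
            μ k l * (phiForm δ l / h28 a l - phiForm δ k / h28 a k) else 0) = 0 := by
  classical
  exact forall_cuspSlope_nonpos_iff_forall_farkas_certificate hpos hT hper
    (M := fun m => Finset.univ.filter fun k => ∃ z : ℤ, bkpt a T m * h28 a k = z)
    (f := fun m A => ((patternN a (bkpt a T m) A : ℤ) : ℝ)) (canonical_junction_agreement a T)
    (canonical_period_eq_sum_inter hF)

end Summit.KontsevichZagierPeriods.Zeta5Search.Barrier.ConeGamma

end
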